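import Summits.SmoothPoincare4.SmoothPoincare4.Theses.EntropyRung
import Summits.SmoothPoincare4.SmoothPoincare4.Theorems.EntropyRungSubcylindricalExistenceCutoffAbsorptionWindows
import Summits.SmoothPoincare4.SmoothPoincare4.Theorems.EntropyRungSubcylindricalExistenceAnnulusPieceFloor
import HarnessLib

/-!
# Cut-off cost absorption by the local Yamabe–Sobolev inequality (helper L1',
stub `helper_cutoffAbsorptionI`, line `fat-conical-core-avr-logsobolev`, crux
`EntropyRung.SubcylindricalExistence`, item stmt-SmoothPoincare4-10871)

On a closed Riemannian 4-manifold `(M, g)` of the summit binder (`dV` the Riemannian measure):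
smooth weight `Φ`, continuous potential `r ≥ 0`, measurable `ϖ`, a smooth partition
`Σⱼ χⱼ² = 1` (`j ≤ n`) and measurable zones `Zᵢ` (`i < n`) such that a piece's gradient lives in
the two adjacent zones and a zone meets only the two adjacent pieces, the log-cut-off bound
`Σⱼ |∇χⱼ|²_g ≤ K ϖ²`, `∫_{Zᵢ} ϖ⁴ ≤ V₀` with `ϖ⁴` integrable on each zone, and the weighted Sobolev
inequality `Y √(∫ u⁴Φ⁴) ≤ ∫ (6Φ²|∇u|² + rΦ⁴u²)`. Then, if `1000 K √V₀ ≤ Y`, for every smooth `u`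
`4 ∫ u²Φ² Σⱼ|∇χⱼ|² ≤ (100 K √V₀ / Y) ∫ (4Φ²|∇u|² + rΦ⁴u²)` (`helper_cutoffAbsorptionI`).

This is the registered `helper_cutoffAbsorption` with the hypothesis `IntegrableOn (ϖ⁴) (Zᵢ)`
added: the registered text only bounds the Bochner integrals `∫_{Zᵢ} ϖ⁴`, which are the junk
value `0` for non-integrable `ϖ⁴`, and then the cost is not controlled (take `V₀ = 0`).

Proof ("local absorption"). With the windows `ηᵢ = χᵢ² + χᵢ₊₁²` (smooth, `ηᵢ = 1` on `Zᵢ`,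
`Σᵢ ηᵢ² ≤ 2`, `Σᵢ|∇ηᵢ|² ≤ 16 Σⱼ|∇χⱼ|²`, file `…CutoffAbsorptionWindows`):
(1) the cost density vanishes off `⋃ Zᵢ` and is `≤ K u²Φ²ϖ²`, so
`C := ∫ u²Φ² Σⱼ|∇χⱼ|² ≤ K Σᵢ ∫_{Zᵢ} u²Φ²ϖ²`; (2) Cauchy–Schwarz on `Zᵢ` and `ηᵢ = 1` there:
`∫_{Zᵢ} u²Φ²ϖ² ≤ √V₀ √(∫ (ηᵢu)⁴Φ⁴)`; (3) Sobolev for `ηᵢ u` and the summed density bound: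
`Y Σᵢ √(∫ (ηᵢu)⁴Φ⁴) ≤ 6 Q + 192 C`, `Q = ∫ (4Φ²|∇u|² + rΦ⁴u²)`; (4) hence
`Y C ≤ K√V₀ (6Q + 192C)` and `1000 K√V₀ ≤ Y` gives `4C ≤ 32 K√V₀ Q / Y`. Folklore (IMS-type
localisation error absorbed by a Sobolev inequality); everything is proved, no named facts.
-/

noncomputable section

-- the registered namespace `Summit.SmoothPoincare4.SmoothPoincare4.Theorems` repeats a component
set_option linter.dupNamespace false

open scoped Manifold ContDiff Topology ENNReal NNReal
open Set Filter MeasureTheory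
open Literature.Geometry.Lorentzian Literature.Geometry.Riemannian

namespace Summit.SmoothPoincare4.SmoothPoincare4.Theorems

namespace CutoffAbsorption

variable {M : Type} [TopologicalSpace M]
  [ChartedSpace (EuclideanSpace ℝ (Fin 4)) M] [IsManifold (𝓡 4) ∞ M]
  (g : PseudoRiemannianMetric (𝓡 4) ∞ (EuclideanSpace ℝ (Fin 4)) (TangentSpace (𝓡 4) : M → Type _))

/-! ### The integrated absorption inequality -/

section Integral

variable [CompactSpace M] [T3Space M] [MeasurableSpace M] [BorelSpace M]

/-- **Cut-off cost absorption (internal form).** With windows `ηᵢ = χᵢ² + χᵢ₊₁²`: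
`C = ∫ u²Φ² Σⱼ|∇χⱼ|² ≤ K Σᵢ ∫_{Zᵢ} u²Φ²ϖ² ≤ K √V₀ Σᵢ √(∫ (ηᵢu)⁴Φ⁴)` (support of the gradients,
Cauchy–Schwarz on each zone, `ηᵢ = 1` on `Zᵢ`), while the Sobolev inequality for the `ηᵢ u` and
the summed density bound give `Y Σᵢ √(∫ (ηᵢu)⁴Φ⁴) ≤ 6 Q + 192 C`; with `1000 K √V₀ ≤ Y` this
closes up to `4 C ≤ (100 K √V₀ / Y) Q`. -/
theorem four_mul_cost_le (hg : g.IsRiemannian) {Φ r ϖ : M → ℝ} {n : ℕ} {χ : Fin (n + 1) → M → ℝ}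
    {Z : Fin n → Set M} {K V₀ Y : ℝ}
    (hΦ : ContMDiff (𝓡 4) 𝓘(ℝ, ℝ) ∞ Φ) (hr : Continuous r) (hr0 : ∀ x, 0 ≤ r x) (hϖm : Measurable ϖ)
    (hχ : ∀ j, ContMDiff (𝓡 4) 𝓘(ℝ, ℝ) ∞ (χ j)) (h1 : ∀ x, ∑ j, χ j x ^ 2 = 1)
    (hZm : ∀ i, MeasurableSet (Z i)) (hK : 0 ≤ K) (hY : 0 < Y)
    (hZ1 : ∀ (j : Fin (n + 1)) (x : M), g.gradSq (χ j) x ≠ 0 →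
      ∃ i : Fin n, ((i : ℕ) = (j : ℕ) ∨ (i : ℕ) + 1 = (j : ℕ)) ∧ x ∈ Z i)
    (hZ2 : ∀ (i : Fin n) (x : M), x ∈ Z i → ∀ j : Fin (n + 1), χ j x ≠ 0 →
      ((j : ℕ) = (i : ℕ) ∨ (j : ℕ) = (i : ℕ) + 1))
    (hB1 : ∀ x : M, ∑ j, g.gradSq (χ j) x ≤ K * ϖ x ^ 2)
    (hB2 : ∀ i : Fin n, ∫ x in Z i, ϖ x ^ 4 ∂(riemannianMeasure (g.toContMDiffRiemannianMetric hg)) ≤ V₀)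
    (hInt : ∀ i : Fin n, IntegrableOn (fun x ↦ ϖ x ^ 4) (Z i)
      (riemannianMeasure (g.toContMDiffRiemannianMetric hg)))
    (hsob : ∀ u : M → ℝ, ContMDiff (𝓡 4) 𝓘(ℝ, ℝ) ∞ u →
      Y * Real.sqrt (∫ x, u x ^ 4 * Φ x ^ 4 ∂(riemannianMeasure (g.toContMDiffRiemannianMetric hg))) ≤
        ∫ x, (6 * (Φ x ^ 2 * g.gradSq u x) + r x * Φ x ^ 4 * u x ^ 2)
          ∂(riemannianMeasure (g.toContMDiffRiemannianMetric hg)))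
    (hsmall : 1000 * K * Real.sqrt V₀ ≤ Y) {u : M → ℝ} (hu : ContMDiff (𝓡 4) 𝓘(ℝ, ℝ) ∞ u) :
    4 * ∫ x, u x ^ 2 * Φ x ^ 2 * (∑ j, g.gradSq (χ j) x)
        ∂(riemannianMeasure (g.toContMDiffRiemannianMetric hg)) ≤
      (100 * K * Real.sqrt V₀ / Y) *
        ∫ x, (4 * (Φ x ^ 2 * g.gradSq u x) + r x * Φ x ^ 4 * u x ^ 2)
          ∂(riemannianMeasure (g.toContMDiffRiemannianMetric hg)) := by
  set μ : Measure M := riemannianMeasure (g.toContMDiffRiemannianMetric hg) with hμ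
  haveI hμfin : IsFiniteMeasure μ := isFiniteMeasure_riemannianMeasure _
  have hintc : ∀ {F : M → ℝ}, Continuous F → Integrable F μ := fun hF ↦
    EntropyLocalisation.integrable_of_continuous_finite hF μ
  have huc : Continuous u := hu.continuous
  have hΦc : Continuous Φ := hΦ.continuous
  have hG : ∀ j, Continuous (g.gradSq (χ j)) := fun j ↦ (contMDiff_gradSq g (hχ j)).continuous
  have hΨc : Continuous fun x ↦ ∑ j, g.gradSq (χ j) x := continuous_finsetSum _ fun j _ ↦ hG j
  have hGu : Continuous (g.gradSq u) := (contMDiff_gradSq g hu).continuous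
  -- the windows `ηᵢ = χᵢ² + χᵢ₊₁²`
  have hηs : ∀ i : Fin n, ContMDiff (𝓡 4) 𝓘(ℝ, ℝ) ∞ (fun y ↦ χ (Fin.castSucc i) y ^ 2 + χ i.succ y ^ 2) :=
    fun i ↦ ((hχ (Fin.castSucc i)).pow 2).add ((hχ i.succ).pow 2)
  have hηc : ∀ i : Fin n, Continuous (fun y ↦ χ (Fin.castSucc i) y ^ 2 + χ i.succ y ^ 2) :=
    fun i ↦ (hηs i).continuous
  have hηu : ∀ i : Fin n, ContMDiff (𝓡 4) 𝓘(ℝ, ℝ) ∞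
      (fun y ↦ (χ (Fin.castSucc i) y ^ 2 + χ i.succ y ^ 2) * u y) := fun i ↦ (hηs i).mul hu
  -- the quantities
  have hIC : Integrable (fun x ↦ u x ^ 2 * Φ x ^ 2 * (∑ j, g.gradSq (χ j) x)) μ :=
    hintc (((huc.pow 2).mul (hΦc.pow 2)).mul hΨc)
  have hIQ : Integrable (fun x ↦ 4 * (Φ x ^ 2 * g.gradSq u x) + r x * Φ x ^ 4 * u x ^ 2) μ :=
    hintc ((continuous_const.mul ((hΦc.pow 2).mul hGu)).add ((hr.mul (hΦc.pow 4)).mul (huc.pow 2)))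
  set C : ℝ := ∫ x, u x ^ 2 * Φ x ^ 2 * (∑ j, g.gradSq (χ j) x) ∂μ with hC
  set Q : ℝ := ∫ x, (4 * (Φ x ^ 2 * g.gradSq u x) + r x * Φ x ^ 4 * u x ^ 2) ∂μ with hQ
  set T : ℝ := ∑ i : Fin n, Real.sqrt (∫ x, ((χ (Fin.castSucc i) x ^ 2 + χ i.succ x ^ 2) * u x) ^ 4 * Φ x ^ 4 ∂μ)
    with hT
  have hC0 : 0 ≤ C := integral_nonneg fun x ↦
    mul_nonneg (by positivity) (Finset.sum_nonneg fun j _ ↦ g.gradSq_nonneg hg _ x)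
  have hQ0 : 0 ≤ Q := integral_nonneg fun x ↦ by
    have := hr0 x; have := g.gradSq_nonneg hg u x; positivity
  -- Step 1: Sobolev for the windowed functions, summed: `Y T ≤ 6 Q + 192 C`
  have step1 : Y * T ≤ 6 * Q + 192 * C := by
    have hIF : ∀ i : Fin n, Integrable (fun x ↦
        6 * (Φ x ^ 2 * g.gradSq (fun y ↦ (χ (Fin.castSucc i) y ^ 2 + χ i.succ y ^ 2) * u y) x)
          + r x * Φ x ^ 4 * ((χ (Fin.castSucc i) x ^ 2 + χ i.succ x ^ 2) * u x) ^ 2) μ := fun i ↦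
      hintc ((continuous_const.mul ((hΦc.pow 2).mul (contMDiff_gradSq g (hηu i)).continuous)).add
        ((hr.mul (hΦc.pow 4)).mul (((hηc i).mul huc).pow 2)))
    have hI1 : Integrable (fun x ↦ ∑ i : Fin n, (6 * (Φ x ^ 2 *
            g.gradSq (fun y ↦ (χ (Fin.castSucc i) y ^ 2 + χ i.succ y ^ 2) * u y) x)
          + r x * Φ x ^ 4 * ((χ (Fin.castSucc i) x ^ 2 + χ i.succ x ^ 2) * u x) ^ 2)) μ :=
      integrable_finsetSum _ fun i _ ↦ hIF i
    have hI6 : Integrable (fun x ↦ 6 * (4 * (Φ x ^ 2 * g.gradSq u x) + r x * Φ x ^ 4 * u x ^ 2)) μ :=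
      hIQ.const_mul 6
    have hI192 : Integrable (fun x ↦ 192 * (u x ^ 2 * Φ x ^ 2 * ∑ j, g.gradSq (χ j) x)) μ :=
      hIC.const_mul 192
    have hI2 : Integrable (fun x ↦ 6 * (4 * (Φ x ^ 2 * g.gradSq u x) + r x * Φ x ^ 4 * u x ^ 2)
          + 192 * (u x ^ 2 * Φ x ^ 2 * ∑ j, g.gradSq (χ j) x)) μ := hI6.add hI192
    have hmono := integral_mono hI1 hI2 fun x ↦ sum_sobolevDensity_window_le g hg h1 hχ hu Φ hr0 x
    have hsplit : ∫ x, (6 * (4 * (Φ x ^ 2 * g.gradSq u x) + r x * Φ x ^ 4 * u x ^ 2)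
          + 192 * (u x ^ 2 * Φ x ^ 2 * ∑ j, g.gradSq (χ j) x)) ∂μ = 6 * Q + 192 * C := by
      rw [integral_add hI6 hI192, integral_const_mul, integral_const_mul]
    calc Y * T = ∑ i : Fin n, Y * Real.sqrt
          (∫ x, ((χ (Fin.castSucc i) x ^ 2 + χ i.succ x ^ 2) * u x) ^ 4 * Φ x ^ 4 ∂μ) := by
          rw [hT, Finset.mul_sum]
      _ ≤ ∑ i : Fin n, ∫ x, (6 * (Φ x ^ 2 *
            g.gradSq (fun y ↦ (χ (Fin.castSucc i) y ^ 2 + χ i.succ y ^ 2) * u y) x)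
          + r x * Φ x ^ 4 * ((χ (Fin.castSucc i) x ^ 2 + χ i.succ x ^ 2) * u x) ^ 2) ∂μ :=
          Finset.sum_le_sum fun i _ ↦ hsob _ (hηu i)
      _ = ∫ x, ∑ i : Fin n, (6 * (Φ x ^ 2 *
            g.gradSq (fun y ↦ (χ (Fin.castSucc i) y ^ 2 + χ i.succ y ^ 2) * u y) x)
          + r x * Φ x ^ 4 * ((χ (Fin.castSucc i) x ^ 2 + χ i.succ x ^ 2) * u x) ^ 2) ∂μ :=
          (integral_finsetSum _ fun i _ ↦ hIF i).symm
      _ ≤ ∫ x, (6 * (4 * (Φ x ^ 2 * g.gradSq u x) + r x * Φ x ^ 4 * u x ^ 2)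
          + 192 * (u x ^ 2 * Φ x ^ 2 * ∑ j, g.gradSq (χ j) x)) ∂μ := hmono
      _ = 6 * Q + 192 * C := hsplit
  -- Step 2: support of the gradients and Cauchy–Schwarz on the zones: `C ≤ K √V₀ T`
  have step2 : C ≤ K * (Real.sqrt V₀ * T) := by
    set f : M → ℝ := fun x ↦ u x ^ 2 * Φ x ^ 2 with hf
    set h : M → ℝ := fun x ↦ ϖ x ^ 2 with hh
    have hfc : Continuous f := (huc.pow 2).mul (hΦc.pow 2)
    have hf0 : ∀ x, 0 ≤ f x := fun x ↦ by positivity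
    have hh0 : ∀ x, 0 ≤ h x := fun x ↦ by positivity
    obtain ⟨B, hB⟩ := (isCompact_range hfc).isBounded.exists_norm_le
    have hfB : ∀ x, ‖f x‖ ≤ B := fun x ↦ hB _ ⟨x, rfl⟩
    have hh4 : (fun x ↦ h x ^ 2) = fun x ↦ ϖ x ^ 4 := funext fun x ↦ by simp only [hh]; ring
    have hhmem : ∀ i, MemLp h 2 (μ.restrict (Z i)) := fun i ↦ by
      rw [memLp_two_iff_integrable_sq (hϖm.pow_const 2).aestronglyMeasurable, hh4]; exact hInt i
    have hfmem : ∀ i, MemLp f 2 (μ.restrict (Z i)) := fun i ↦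
      MemLp.of_bound hfc.aestronglyMeasurable B (ae_of_all _ hfB)
    have hfh : ∀ i, IntegrableOn (fun x ↦ K * (f x * h x)) (Z i) μ := fun i ↦
      (((hhmem i).integrable one_le_two).bdd_mul hfc.aestronglyMeasurable (ae_of_all _ hfB)).const_mul K
    -- Cauchy–Schwarz on `Z i`, `ηᵢ = 1` on `Z i`
    have hS : ∀ i : Fin n, ∫ x in Z i, f x * h x ∂μ ≤
        Real.sqrt (∫ x, ((χ (Fin.castSucc i) x ^ 2 + χ i.succ x ^ 2) * u x) ^ 4 * Φ x ^ 4 ∂μ) * Real.sqrt V₀ := by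
      intro i
      have hcs := AnnulusPieceFloor.integral_mul_le_sqrt_mul_sqrt (ν := μ.restrict (Z i)) hf0 hh0 (hfmem i) (hhmem i)
      have e1 : Real.sqrt (∫ x in Z i, f x ^ 2 ∂μ) ≤
          Real.sqrt (∫ x, ((χ (Fin.castSucc i) x ^ 2 + χ i.succ x ^ 2) * u x) ^ 4 * Φ x ^ 4 ∂μ) := by
        apply Real.sqrt_le_sqrt
        have heq : ∫ x in Z i, f x ^ 2 ∂μ =
            ∫ x in Z i, ((χ (Fin.castSucc i) x ^ 2 + χ i.succ x ^ 2) * u x) ^ 4 * Φ x ^ 4 ∂μ := by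
          refine setIntegral_congr_fun (hZm i) fun x hx ↦ ?_
          rw [window_eq_one h1 i (hZ2 i x hx)]
          simp only [hf]; ring
        rw [heq]
        exact setIntegral_le_integral (hintc ((((hηc i).mul huc).pow 4).mul (hΦc.pow 4)))
          (ae_of_all _ fun x ↦ by positivity)
      have e2 : Real.sqrt (∫ x in Z i, h x ^ 2 ∂μ) ≤ Real.sqrt V₀ := by
        apply Real.sqrt_le_sqrt; rw [hh4]; exact hB2 i
      exact hcs.trans (mul_le_mul e1 e2 (Real.sqrt_nonneg _) (Real.sqrt_nonneg _))
    -- the cost density is dominated by `Σᵢ 1_{Zᵢ} K f h`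
    have hpt : ∀ x, u x ^ 2 * Φ x ^ 2 * (∑ j, g.gradSq (χ j) x) ≤
        ∑ i : Fin n, (Z i).indicator (fun y ↦ K * (f y * h y)) x := by
      intro x
      have hnn : ∀ i : Fin n, 0 ≤ (Z i).indicator (fun y ↦ K * (f y * h y)) x := fun i ↦
        Set.indicator_nonneg (fun y _ ↦ mul_nonneg hK (mul_nonneg (hf0 y) (hh0 y))) x
      by_cases hΨ : ∑ j, g.gradSq (χ j) x = 0
      · rw [hΨ, mul_zero]; exact Finset.sum_nonneg fun i _ ↦ hnn i
      · obtain ⟨j, hj⟩ : ∃ j, g.gradSq (χ j) x ≠ 0 := by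
          by_contra hcon
          push Not at hcon
          exact hΨ (Finset.sum_eq_zero fun j _ ↦ hcon j)
        obtain ⟨i, -, hxi⟩ := hZ1 j x hj
        calc u x ^ 2 * Φ x ^ 2 * (∑ j, g.gradSq (χ j) x) ≤ u x ^ 2 * Φ x ^ 2 * (K * ϖ x ^ 2) :=
              mul_le_mul_of_nonneg_left (hB1 x) (by positivity)
          _ = (Z i).indicator (fun y ↦ K * (f y * h y)) x := by
              rw [indicator_of_mem hxi]; simp only [hf, hh]; ring
          _ ≤ ∑ i' : Fin n, (Z i').indicator (fun y ↦ K * (f y * h y)) x :=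
              Finset.single_le_sum (f := fun i' ↦ (Z i').indicator (fun y ↦ K * (f y * h y)) x)
                (fun i' _ ↦ hnn i') (Finset.mem_univ i)
    have hIind : ∀ i : Fin n, Integrable ((Z i).indicator (fun y ↦ K * (f y * h y))) μ := fun i ↦
      (hfh i).integrable_indicator (hZm i)
    have hIsum : Integrable (fun x ↦ ∑ i : Fin n, (Z i).indicator (fun y ↦ K * (f y * h y)) x) μ :=
      integrable_finsetSum _ fun i _ ↦ hIind i
    have hmono := integral_mono hIC hIsum hpt
    calc C ≤ ∫ x, ∑ i : Fin n, (Z i).indicator (fun y ↦ K * (f y * h y)) x ∂μ := hmono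
      _ = ∑ i : Fin n, K * ∫ x in Z i, f x * h x ∂μ := by
          rw [integral_finsetSum _ fun i _ ↦ hIind i]
          refine Finset.sum_congr rfl fun i _ ↦ ?_
          rw [integral_indicator (hZm i), integral_const_mul]
      _ ≤ ∑ i : Fin n, K * (Real.sqrt
          (∫ x, ((χ (Fin.castSucc i) x ^ 2 + χ i.succ x ^ 2) * u x) ^ 4 * Φ x ^ 4 ∂μ) * Real.sqrt V₀) :=
          Finset.sum_le_sum fun i _ ↦ mul_le_mul_of_nonneg_left (hS i) hK
      _ = K * (Real.sqrt V₀ * T) := by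
          rw [hT, ← Finset.mul_sum, ← Finset.sum_mul, mul_comm _ (Real.sqrt V₀)]
  -- Step 3: close up
  have hV : 0 ≤ Real.sqrt V₀ := Real.sqrt_nonneg _
  have hb0 : 0 ≤ K * Real.sqrt V₀ := mul_nonneg hK hV
  have hT0 : 0 ≤ T := Finset.sum_nonneg fun i _ ↦ Real.sqrt_nonneg _
  have k1 : Y * C ≤ K * Real.sqrt V₀ * (6 * Q + 192 * C) :=
    calc Y * C ≤ Y * (K * (Real.sqrt V₀ * T)) := mul_le_mul_of_nonneg_left step2 hY.le
      _ = K * Real.sqrt V₀ * (Y * T) := by ring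
      _ ≤ K * Real.sqrt V₀ * (6 * Q + 192 * C) := mul_le_mul_of_nonneg_left step1 hb0
  have k2 : K * Real.sqrt V₀ * C ≤ Y / 1000 * C := mul_le_mul_of_nonneg_right (by linarith) hC0
  have kbq : 0 ≤ K * Real.sqrt V₀ * Q := mul_nonneg hb0 hQ0
  have k3 : Y * C ≤ 8 * (K * Real.sqrt V₀ * Q) := by nlinarith
  rw [div_mul_eq_mul_div, le_div_iff₀ hY]
  nlinarith

end Integral

end CutoffAbsorption

/-- **Helper L1' (stub `helper_cutoffAbsorptionI`) — cut-off cost absorption by the local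
Yamabe–Sobolev inequality.** For a partition `Σⱼ χⱼ² = 1` whose gradients live in zones `Zᵢ`
(a zone meets only the two adjacent pieces, a piece's gradient only the two adjacent zones), with
the log-cut-off bound `Σⱼ|∇χⱼ|²_g ≤ K ϖ²`, zone `ϖ⁴`-volume `≤ V₀` with `ϖ⁴` integrable on each
zone, and the weighted Sobolev inequality with constant `Y`, the cut-off cost is the fraction
`100 K √V₀ / Y` of the weighted Dirichlet–curvature form as soon as `1000 K √V₀ ≤ Y`. This is the
registered `helper_cutoffAbsorption` with the hypothesis `IntegrableOn (ϖ⁴) (Z i)` added (the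
registered text only bounds the Bochner integrals `∫_{Zᵢ} ϖ⁴`, junk `0` when non-integrable). -/
theorem helper_cutoffAbsorptionI :
    ∀ (M : Type) [TopologicalSpace M] [T2Space M] [SecondCountableTopology M]
          [ChartedSpace (EuclideanSpace ℝ (Fin 4)) M] [IsManifold (𝓡 4) ∞ M] [CompactSpace M]
          [T3Space M] [MeasurableSpace M] [BorelSpace M]
          (g : PseudoRiemannianMetric (𝓡 4) ∞ (EuclideanSpace ℝ (Fin 4)) (TangentSpace (𝓡 4) : M → Type _))
          [g.HasLeviCivita] (hg : g.IsRiemannian) (Φ r ϖ : M → ℝ) (n : ℕ) (χ : Fin (n + 1) → M → ℝ)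
          (Z : Fin n → Set M) (K V₀ Y : ℝ),
          ContMDiff (𝓡 4) 𝓘(ℝ, ℝ) ∞ Φ → (∀ x, 0 < Φ x) → Continuous r → (∀ x, 0 ≤ r x) →
          Measurable ϖ → (∀ x, 0 ≤ ϖ x) →
          (∀ j, ContMDiff (𝓡 4) 𝓘(ℝ, ℝ) ∞ (χ j)) → (∀ x, ∑ j, χ j x ^ 2 = 1) →
          (∀ i, MeasurableSet (Z i)) → 0 ≤ K → 0 ≤ V₀ → 0 < Y →
          (∀ (j : Fin (n + 1)) (x : M), g.gradSq (χ j) x ≠ 0 →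
            ∃ i : Fin n, ((i : ℕ) = (j : ℕ) ∨ (i : ℕ) + 1 = (j : ℕ)) ∧ x ∈ Z i) →
          (∀ (i : Fin n) (x : M), x ∈ Z i → ∀ j : Fin (n + 1), χ j x ≠ 0 →
            ((j : ℕ) = (i : ℕ) ∨ (j : ℕ) = (i : ℕ) + 1)) →
          (∀ x : M, ∑ j, g.gradSq (χ j) x ≤ K * ϖ x ^ 2) →
          (∀ i : Fin n, ∫ x in Z i, ϖ x ^ 4 ∂(riemannianMeasure (g.toContMDiffRiemannianMetric hg)) ≤ V₀) →
          (∀ i : Fin n, IntegrableOn (fun x ↦ ϖ x ^ 4) (Z i) (riemannianMeasure (g.toContMDiffRiemannianMetric hg))) →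
          (∀ u : M → ℝ, ContMDiff (𝓡 4) 𝓘(ℝ, ℝ) ∞ u →
            Y * Real.sqrt (∫ x, u x ^ 4 * Φ x ^ 4 ∂(riemannianMeasure (g.toContMDiffRiemannianMetric hg))) ≤
              ∫ x, (6 * (Φ x ^ 2 * g.gradSq u x) + r x * Φ x ^ 4 * u x ^ 2)
                ∂(riemannianMeasure (g.toContMDiffRiemannianMetric hg))) →
          1000 * K * Real.sqrt V₀ ≤ Y →
          ∀ u : M → ℝ, ContMDiff (𝓡 4) 𝓘(ℝ, ℝ) ∞ u →
            4 * ∫ x, u x ^ 2 * Φ x ^ 2 * (∑ j, g.gradSq (χ j) x)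
                ∂(riemannianMeasure (g.toContMDiffRiemannianMetric hg)) ≤
              (100 * K * Real.sqrt V₀ / Y) *
                ∫ x, (4 * (Φ x ^ 2 * g.gradSq u x) + r x * Φ x ^ 4 * u x ^ 2)
                  ∂(riemannianMeasure (g.toContMDiffRiemannianMetric hg)) := by
  intro M _ _ _ _ _ _ _ _ _ g _ hg Φ r ϖ n χ Z K V₀ Y hΦ _ hr hr0 hϖm _ hχ h1 hZm hK _ hY hZ1 hZ2 hB1 hB2
    hInt hsob hsmall u hu
  exact CutoffAbsorption.four_mul_cost_le g hg hΦ hr hr0 hϖm hχ h1 hZm hK hY hZ1 hZ2 hB1 hB2 hInt hsob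
    hsmall hu

end Summit.SmoothPoincare4.SmoothPoincare4.Theorems

end
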